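import Summits.QuantumFields.BalabanUV.Beta.GAN24.TaylorTrilinearPairing

/-!
# `BalabanUV.Beta.GAN24.TaylorTrilinearDiffSlices` — binder row G-an2-4 ∕ (CONV-C), S-slot, road «S3-Taylor», DIFF row R3-dW:
# generic leaf, PART 3 of 7 — SLICES OF THE UNIT SANDWICH: trilinear split, mirror symmetry, and A DIFFERENCE LEG ON A TABLE
# SITE by zero row sum + ONE ABEL SUMMATION in the vertex location (pointwise lemmas)

G-an2-4 formalisation swarm, leaf prover 15 (unit `b2b-balaban-gan24-formalise-leaf-15`, gen 14; DIFF row R3-dW holder, INTENT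
CLAIMS.log l.4908).  HONEST FRAMING (cell rule, verbatim): «discharging `BetaPertH` makes Bałaban's UV stability UNCONDITIONAL — a
real constructive-QFT result; it is NOT the continuum limit and NOT the Clay problem.»  HONEST DEPENDENCY (verbatim): «continuum YM
on T⁴ ⇐ BetaPertH ∧ nine spine estimates (0/9 proved); BetaPertH ⇐ (D1) ∧ (D4) ∧ CAP+tail; G-an2-4 gates asym, D1 and NE2/3/4.»
NOT IN PRINT; OUR BOOKKEEPING ([folklore]): elementary real analysis ∕ finite algebra on `ℤ^{d+1}`, GENERIC `d`, GENERIC blockings,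
ABSTRACT legs and table; NO object of an2's typed `U = 1` system occurs, nothing is cited, no `def … : Prop`, NOTHING is asserted
or discharged of «E3Shape»∕«E3SupRate» (OPEN, not in print), of (hS, hSall), of the K-slot, of `BetaPertH`.
NOT BetaPertH, NOT continuum, NOT Clay.

CONTEXT (asserted nowhere below).  The RATE table of the S-slot (`GAN24/StencilSlotE3RateOfPieces.e3SupRate_of_pieces`,
row owner gan24-p1) has the DIFFERENCE row R3-dW: the Wilson piece of the normalised third jet at member `n+3` (blocking
`N′ = N·Lc`) minus the one at member `n+2` (blocking `N`), `≤ cW·θ^{n+1}`.  By `E3UnitSplit.e3W_unit_split` both are (at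
`d = 3`, residual `1`) the SAME unit sandwich functional — three legs, one block average, ONE explicit factor of the blocking
on the SAME translation-invariant zero-row-sum table `wilsonA` — read at two blockings.  This chain of generic leaves
(`TaylorTrilinearCarry` ∕ `…Pairing` ∕ `…DiffSlices` ∕ `…DiffSummed` ∕ `…Transport` ∕ `…TransportBound` ∕ `…Diff`) proves the
two-level difference bound `TaylorTrilinearDiff.trilinear_diff_bound`: TRANSPORT the level-`N` legs to the finer lattice by
`quo Lc` (piecewise constant on cells), split trilinearly — the couplings «(N1-Cauchy)» enter BY THEIR SUP ONLY thanks to ONE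
ABEL SUMMATION in the vertex location — and compare the transported functional with the original one EXACTLY through the
CARRY TABLE of a cell (Hermite's identity: same row sum, same first moments ⇒ second order ⇒ `O(1/N)` by the pairing lemma).

## What is proved ([folklore], `0 sorry`; ONE plumbing `def`: `slice c ν G K H T B u` = the summand of
## `TaylorTrilinearLattice.sandwich_reorder`'s right-hand side at vertex location `u`)
* §1 `slice`, `sandwich_eq_tsum_slice` (the VERBATIM nesting of `e3W_unit_split` = `Σ'_u slice`), **`slice_sub_slice`** (TRILINEAR
  SPLIT into three one-difference-leg slices), `slice_swap` (mirror symmetry `w ↔ y`), `slice_eq_mul_slice_one`, `slice_weights`,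
  `swap_rowsum`.
* §2 `slice_eq_stepD_add_stepK` (zero row sum: the slice with the difference leg `D` on the `w`-site = `D`-step term + `K`-step term),
  `abs_stepK_le` (pointwise), `summable_DHK`, **`tsum_stepD_eq`** (THE ABEL STEP: `Σ'_u Σ cν (D(u+s) − D u)·H u·T₀·K(u+t)
  = Σ'_u Σ cν D u·T₀·(H(u−s)K(u−s+t) − H u K(u+t))` — `D` is never differenced), `abs_stepD_shifted_le` (pointwise after Abel).
-/

noncomputable section

open Finset
open scoped BigOperators
open Literature.MathematicalPhysics.QuantumFieldTheory Balaban1983to89 Balaban1983to89.Beta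
open B12Sec2to5 (l1 l1_nonneg)
open ExpKernelCalculus (Zl l1_sub_triangle l1_sub_symm)
open LatticeForm (quo)

namespace Summit.QuantumFields.BalabanUV.Beta.GAN24.TaylorTrilinearDiffSlices

open Summit.QuantumFields.BalabanUV.Beta.GAN24.TaylorTrilinearLattice
open Summit.QuantumFields.BalabanUV.Beta.GAN24.TaylorTrilinear (nonneg_of_abs_le_mul_exp abs_le_of_abs_le_mul_exp)
open Summit.QuantumFields.BalabanUV.Beta.GAN24.TaylorTrilinearPairing

variable {d : ℕ}

/-! ## §1 The reordered slice of the unit sandwich at a vertex location; trilinear split; mirror symmetry -/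

/-- [folklore] THE SLICE at vertex location `u` of the reordered unit sandwich (the summand of
`TaylorTrilinearLattice.sandwich_reorder`'s right-hand side): `Σ_{t,s∈B} Σ_{l′,l,κ} c·ν·(G l (u+s)·H κ u·T κ u (u+s) (u+t) l l′·K l′ (u+t))`. -/
def slice (c ν : ℝ) (G K H : Fin (d + 1) → (Fin (d + 1) → ℤ) → ℝ)
    (T : Fin (d + 1) → (Fin (d + 1) → ℤ) → (Fin (d + 1) → ℤ) → (Fin (d + 1) → ℤ) → Fin (d + 1) → Fin (d + 1) → ℝ)
    (B : Finset (Fin (d + 1) → ℤ)) (u : Fin (d + 1) → ℤ) : ℝ :=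
  ∑ t ∈ B, ∑ s ∈ B, ∑ l' : Fin (d + 1), ∑ l : Fin (d + 1), ∑ κ : Fin (d + 1),
    c * ν * (G l (u + s) * H κ u * T κ u (u + s) (u + t) l l' * K l' (u + t))

section Algebra

variable (c ν : ℝ) (G K H G₁ K₁ H₁ : Fin (d + 1) → (Fin (d + 1) → ℤ) → ℝ)
  (T : Fin (d + 1) → (Fin (d + 1) → ℤ) → (Fin (d + 1) → ℤ) → (Fin (d + 1) → ℤ) → Fin (d + 1) → Fin (d + 1) → ℝ)
  (B : Finset (Fin (d + 1) → ℤ))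

/-- [folklore] The sandwich in the VERBATIM nesting of `E3UnitSplit.e3W_unit_split` is the lattice sum of its slices
(`TaylorTrilinearLattice.sandwich_reorder`, restated with `slice`). -/
theorem sandwich_eq_tsum_slice (hTw : ∀ κ u w y l l', w - u ∉ B → T κ u w y l l' = 0)
    (hTy : ∀ κ u w y l l', y - u ∉ B → T κ u w y l l' = 0)
    (hS : ∀ t ∈ B, ∀ s ∈ B, Summable fun u : Fin (d + 1) → ℤ =>
      ∑ l', ∑ l, ∑ κ, c * ν * (G l (u + s) * H κ u * T κ u (u + s) (u + t) l l' * K l' (u + t))) :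
    (∑' y, ∑ l', (∑' w, ∑ l, G l w * ∑ κ, c * ∑' u, H κ u * (ν * T κ u w y l l')) * K l' y) =
      ∑' u, slice c ν G K H T B u :=
  sandwich_reorder G K H T B c ν hTw hTy hS

/-- [folklore] **TRILINEAR SPLIT** of a difference of slices into three slices with ONE difference leg each:
`a₁h₁k₁ − a h k = (a₁−a)h₁k₁ + a(h₁−h)k₁ + a h(k₁−k)`. -/
theorem slice_sub_slice (u : Fin (d + 1) → ℤ) :
    slice c ν G₁ K₁ H₁ T B u - slice c ν G K H T B u =
      slice c ν (fun l w => G₁ l w - G l w) K₁ H₁ T B u + slice c ν G K₁ (fun κ v => H₁ κ v - H κ v) T B u +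
        slice c ν G (fun l' y => K₁ l' y - K l' y) H T B u := by
  simp only [slice, ← Finset.sum_sub_distrib, ← Finset.sum_add_distrib]
  refine Finset.sum_congr rfl fun t _ => Finset.sum_congr rfl fun s _ => Finset.sum_congr rfl fun l' _ =>
    Finset.sum_congr rfl fun l _ => Finset.sum_congr rfl fun κ _ => ?_
  ring

/-- [folklore] **MIRROR SYMMETRY** of the slice: exchanging the two table legs (and the table's site and index slots)
leaves the slice unchanged — so an estimate for a difference leg on the `w`-site gives the one on the `y`-site. -/
theorem slice_swap (u : Fin (d + 1) → ℤ) :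
    slice c ν G K H T B u = slice c ν K G H (fun κ v w y l l' => T κ v y w l' l) B u := by
  unfold slice
  rw [Finset.sum_comm]
  refine Finset.sum_congr rfl fun s _ => Finset.sum_congr rfl fun t _ => ?_
  rw [Finset.sum_comm]
  exact Finset.sum_congr rfl fun l _ => Finset.sum_congr rfl fun l' _ => Finset.sum_congr rfl fun κ _ => by ring

/-- [folklore] The weight `c` factors out of the slice. -/
theorem slice_eq_mul_slice_one (u : Fin (d + 1) → ℤ) : slice c ν G K H T B u = c * slice 1 ν G K H T B u := by
  simp only [slice, Finset.mul_sum, one_mul]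
  exact Finset.sum_congr rfl fun _ _ => Finset.sum_congr rfl fun _ _ => Finset.sum_congr rfl fun _ _ =>
    Finset.sum_congr rfl fun _ _ => Finset.sum_congr rfl fun _ _ => by ring

/-- [folklore] Only the product of the two weights matters. -/
theorem slice_weights (u : Fin (d + 1) → ℤ) : slice c ν G K H T B u = slice (c * ν) 1 G K H T B u := by
  simp only [slice, mul_one]

/-- [folklore] Zero row sums pass to the mirrored table. -/
theorem swap_rowsum (hTsum : ∀ κ u l l', ∑ s ∈ B, ∑ t ∈ B, T κ u (u + s) (u + t) l l' = 0)
    (κ : Fin (d + 1)) (u : Fin (d + 1) → ℤ) (l l' : Fin (d + 1)) :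
    ∑ s ∈ B, ∑ t ∈ B, (fun κ v w y l l' => T κ v y w l' l) κ u (u + s) (u + t) l l' = 0 := by
  simp only
  rw [Finset.sum_comm]; exact hTsum κ u l' l

end Algebra

/-! ## §2 A DIFFERENCE LEG ON A TABLE SITE: zero row sum, then ONE ABEL SUMMATION in the vertex location -/

section DiffLeg

variable (M : ℕ) [NeZero M] (c ν : ℝ) (D K H : Fin (d + 1) → (Fin (d + 1) → ℤ) → ℝ)
  (T : Fin (d + 1) → (Fin (d + 1) → ℤ) → (Fin (d + 1) → ℤ) → (Fin (d + 1) → ℤ) → Fin (d + 1) → Fin (d + 1) → ℝ)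
  (B : Finset (Fin (d + 1) → ℤ)) (x' z' u' : Fin (d + 1) → ℤ) {δ εD CK CK' CH CH' CT : ℝ} {R : ℕ}

/-- [folklore] ZERO ROW SUM ⇒ the slice with the difference leg `D` on the `w`-site splits as
`Σ c ν H T (D(u+s) − D u) K(u+t) + Σ c ν H T D u (K(u+t) − K u)` (the `u`-diagonal term `D u·K u` is subtracted for free). -/
theorem slice_eq_stepD_add_stepK (hTsum : ∀ κ u l l', ∑ s ∈ B, ∑ t ∈ B, T κ u (u + s) (u + t) l l' = 0)
    (u : Fin (d + 1) → ℤ) :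
    slice c ν D K H T B u =
      (∑ t ∈ B, ∑ s ∈ B, ∑ l' : Fin (d + 1), ∑ l : Fin (d + 1), ∑ κ : Fin (d + 1),
        c * ν * ((D l (u + s) - D l u) * H κ u * T κ u (u + s) (u + t) l l' * K l' (u + t))) +
      ∑ t ∈ B, ∑ s ∈ B, ∑ l' : Fin (d + 1), ∑ l : Fin (d + 1), ∑ κ : Fin (d + 1),
        c * ν * (D l u * H κ u * T κ u (u + s) (u + t) l l' * (K l' (u + t) - K l' u)) := by
  have hZ : ∑ t ∈ B, ∑ s ∈ B, ∑ l' : Fin (d + 1), ∑ l : Fin (d + 1), ∑ κ : Fin (d + 1),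
      c * ν * (D l u * H κ u * T κ u (u + s) (u + t) l l' * K l' u) = 0 := by
    simp only [Finset.sum_comm (s := B) (t := (Finset.univ : Finset (Fin (d + 1))))]
    refine Finset.sum_eq_zero fun l' _ => Finset.sum_eq_zero fun l _ => Finset.sum_eq_zero fun κ _ => ?_
    have h0 : ∑ t ∈ B, ∑ s ∈ B, T κ u (u + s) (u + t) l l' = 0 := by rw [Finset.sum_comm]; exact hTsum κ u l l'
    calc ∑ t ∈ B, ∑ s ∈ B, c * ν * (D l u * H κ u * T κ u (u + s) (u + t) l l' * K l' u)
        = (c * ν * (D l u * H κ u * K l' u)) * ∑ t ∈ B, ∑ s ∈ B, T κ u (u + s) (u + t) l l' := by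
          rw [Finset.mul_sum]; refine Finset.sum_congr rfl fun t _ => ?_
          rw [Finset.mul_sum]; exact Finset.sum_congr rfl fun s _ => by ring
      _ = 0 := by rw [h0, mul_zero]
  unfold slice
  rw [← sub_zero (∑ t ∈ B, _), ← hZ]
  simp only [← Finset.sum_sub_distrib, ← Finset.sum_add_distrib]
  refine Finset.sum_congr rfl fun t _ => Finset.sum_congr rfl fun s _ => Finset.sum_congr rfl fun l' _ =>
    Finset.sum_congr rfl fun l _ => Finset.sum_congr rfl fun κ _ => ?_
  ring

/-- [folklore] THE `K`-STEP TERM, POINTWISE: one unit gradient of `K` (price `|t|₁ ≤ R`), the sup of `D`: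
`|Σ c ν D u·H u·T·(K(u+t) − K u)| ≤ |B|²(d+1)³·(cν)·C_T·ε_D·C_H·(R·C′_K/M)·e^{3δR}·(three-centre weight at u)`
(the exponential weakened to the common `e^{3δR}` of this section). -/
theorem abs_stepK_le (hc : 0 ≤ c) (hν : 0 ≤ ν) (hδ : 0 ≤ δ)
    (hD : ∀ l w, |D l w| ≤ εD * Real.exp (-δ * l1 (quo M w - x')))
    (hH : ∀ κ v, |H κ v| ≤ CH * Real.exp (-δ * l1 (quo M v - u')))
    (hK' : ∀ l y j, |K l (y + Pi.single j 1) - K l y| ≤ CK' / M * Real.exp (-δ * l1 (quo M y - z')))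
    (hB : ∀ s ∈ B, LatticeForm.l1 s ≤ R) (hT0 : ∀ κ v w y l l', |T κ v w y l l'| ≤ CT) (u : Fin (d + 1) → ℤ) :
    |∑ t ∈ B, ∑ s ∈ B, ∑ l' : Fin (d + 1), ∑ l : Fin (d + 1), ∑ κ : Fin (d + 1),
        c * ν * (D l u * H κ u * T κ u (u + s) (u + t) l l' * (K l' (u + t) - K l' u))| ≤
      ((B.card : ℝ) ^ 2 * ((d : ℝ) + 1) ^ 3 * ((c * ν) * CT * εD * CH * (R * (CK' / M) * Real.exp (3 * δ * R)))) *
        Real.exp (-δ * (l1 (quo M u - x') + l1 (quo M u - u') + l1 (quo M u - z'))) := by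
  have hM : (0 : ℝ) < M := by exact_mod_cast Nat.pos_of_ne_zero (NeZero.ne M)
  have hCK' : 0 ≤ CK' / M := nonneg_of_abs_le_mul_exp hδ (l1_nonneg _) (hK' 0 u 0)
  have hCT : 0 ≤ CT := (abs_nonneg _).trans (hT0 0 u u u 0 0)
  rw [mul_assoc (((B.card : ℝ) ^ 2 * ((d : ℝ) + 1) ^ 3))]
  refine abs_sum5_le B fun t ht s _ l' l κ => ?_
  have e1 := hD l u
  have e2 := hH κ u
  have e3 := hT0 κ u (u + s) (u + t) l l'
  have e4 : |K l' (u + t) - K l' u| ≤ R * (CK' / M) * Real.exp (3 * δ * R) * Real.exp (-δ * l1 (quo M u - z')) := by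
    have h := abs_sub_le_of_unit_steps M hCK' hδ (fun y j => hK' l' y j) u t
    have ht : l1 t ≤ R := l1_le_of_natl1_le (hB t ht)
    have hR : (0 : ℝ) ≤ R := by positivity
    calc |K l' (u + t) - K l' u| ≤ l1 t * (CK' / M) * Real.exp (δ * l1 t) * Real.exp (-δ * l1 (quo M u - z')) := h
      _ ≤ R * (CK' / M) * Real.exp (3 * δ * R) * Real.exp (-δ * l1 (quo M u - z')) := by
          have := l1_nonneg t
          have hexp : Real.exp (δ * l1 t) ≤ Real.exp (3 * δ * R) := Real.exp_le_exp.2 (by nlinarith)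
          gcongr
  have hεD : 0 ≤ εD * Real.exp (-δ * l1 (quo M u - x')) := (abs_nonneg _).trans e1
  have hCH : 0 ≤ CH * Real.exp (-δ * l1 (quo M u - u')) := (abs_nonneg _).trans e2
  rw [abs_mul, abs_of_nonneg (mul_nonneg hc hν), abs_mul, abs_mul, abs_mul]
  calc c * ν * (|D l u| * |H κ u| * |T κ u (u + s) (u + t) l l'| * |K l' (u + t) - K l' u|)
      ≤ c * ν * ((εD * Real.exp (-δ * l1 (quo M u - x'))) * (CH * Real.exp (-δ * l1 (quo M u - u'))) * CT *
          (R * (CK' / M) * Real.exp (3 * δ * R) * Real.exp (-δ * l1 (quo M u - z')))) := by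
        refine mul_le_mul_of_nonneg_left ?_ (mul_nonneg hc hν)
        refine mul_le_mul (mul_le_mul (mul_le_mul e1 e2 (abs_nonneg _) hεD) e3 (abs_nonneg _)
          (mul_nonneg hεD hCH)) e4 (abs_nonneg _) (mul_nonneg (mul_nonneg hεD hCH) hCT)
    _ = _ := by
        rw [show -δ * (l1 (quo M u - x') + l1 (quo M u - u') + l1 (quo M u - z')) =
          -δ * l1 (quo M u - x') + -δ * l1 (quo M u - u') + -δ * l1 (quo M u - z') by ring,
          Real.exp_add, Real.exp_add]
        ring

/-- [folklore] Summability of the two lattice families exchanged by the Abel step. -/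
theorem summable_DHK (hδ : 0 < δ)
    (hD : ∀ l w, |D l w| ≤ εD * Real.exp (-δ * l1 (quo M w - x')))
    (hH : ∀ κ v, |H κ v| ≤ CH * Real.exp (-δ * l1 (quo M v - u')))
    (hK : ∀ l y, |K l y| ≤ CK * Real.exp (-δ * l1 (quo M y - z')))
    (a t : Fin (d + 1) → ℤ) (l' l κ : Fin (d + 1)) :
    Summable fun u : Fin (d + 1) → ℤ => (H κ u * K l' (u + t)) * D l (u + a) := by
  have hεD : 0 ≤ εD := nonneg_of_abs_le_mul_exp hδ.le (l1_nonneg _) (hD l 0)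
  have hCK : 0 ≤ CK := nonneg_of_abs_le_mul_exp hδ.le (l1_nonneg _) (hK l' 0)
  refine summable_of_le_three M (C := CH * (CK * Real.exp (δ * l1 t)) * (εD * Real.exp (δ * l1 a))) hδ
    (x' := x') (u' := u') (z' := z') fun u => ?_
  have e1 := hH κ u
  have e2 : |K l' (u + t)| ≤ CK * Real.exp (δ * l1 t) * Real.exp (-δ * l1 (quo M u - z')) :=
    weight_shift_le M hδ.le hCK u t z' (hK l' (u + t))
  have e3 : |D l (u + a)| ≤ εD * Real.exp (δ * l1 a) * Real.exp (-δ * l1 (quo M u - x')) :=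
    weight_shift_le M hδ.le hεD u a x' (hD l (u + a))
  have hCH : 0 ≤ CH * Real.exp (-δ * l1 (quo M u - u')) := (abs_nonneg _).trans e1
  rw [abs_mul, abs_mul]
  calc |H κ u| * |K l' (u + t)| * |D l (u + a)|
      ≤ (CH * Real.exp (-δ * l1 (quo M u - u'))) * (CK * Real.exp (δ * l1 t) * Real.exp (-δ * l1 (quo M u - z'))) *
          (εD * Real.exp (δ * l1 a) * Real.exp (-δ * l1 (quo M u - x'))) :=
        mul_le_mul (mul_le_mul e1 e2 (abs_nonneg _) hCH) e3 (abs_nonneg _) (mul_nonneg hCH ((abs_nonneg _).trans e2))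
    _ = _ := by
        rw [show -δ * (l1 (quo M u - x') + l1 (quo M u - u') + l1 (quo M u - z')) =
          -δ * l1 (quo M u - x') + -δ * l1 (quo M u - u') + -δ * l1 (quo M u - z') by ring,
          Real.exp_add, Real.exp_add]
        ring

/-- [folklore] **THE ABEL STEP FOR THE `D`-STEP TERM** (translation-invariant table): summed over the vertex location,
`Σ'_u Σ c ν (D(u+s) − D u)·H u·T₀ s t·K(u+t) = Σ'_u Σ c ν D u·T₀ s t·(H(u−s)·K(u−s+t) − H u·K(u+t))` — the difference
now sits on the PRODUCT of the two regular legs, and `D` is never differenced. -/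
theorem tsum_stepD_eq (hδ : 0 < δ)
    (hD : ∀ l w, |D l w| ≤ εD * Real.exp (-δ * l1 (quo M w - x')))
    (hH : ∀ κ v, |H κ v| ≤ CH * Real.exp (-δ * l1 (quo M v - u')))
    (hK : ∀ l y, |K l y| ≤ CK * Real.exp (-δ * l1 (quo M y - z')))
    (hTinv : ∀ κ v s t l l', T κ v (v + s) (v + t) l l' = T κ 0 s t l l') :
    ∑' u, ∑ t ∈ B, ∑ s ∈ B, ∑ l' : Fin (d + 1), ∑ l : Fin (d + 1), ∑ κ : Fin (d + 1),
        c * ν * ((D l (u + s) - D l u) * H κ u * T κ u (u + s) (u + t) l l' * K l' (u + t)) =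
      ∑' u, ∑ t ∈ B, ∑ s ∈ B, ∑ l' : Fin (d + 1), ∑ l : Fin (d + 1), ∑ κ : Fin (d + 1),
        c * ν * (D l u * T κ 0 s t l l' * (H κ (u - s) * K l' (u - s + t) - H κ u * K l' (u + t))) := by
  -- every (t, s, l′, l, κ)-family is summable on both sides
  have hS1 : ∀ t s l' l κ, Summable fun u : Fin (d + 1) → ℤ =>
      c * ν * ((D l (u + s) - D l u) * H κ u * T κ u (u + s) (u + t) l l' * K l' (u + t)) := by
    intro t s l' l κ
    have h := ((summable_DHK M D K H x' z' u' hδ hD hH hK s t l' l κ).sub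
      (summable_DHK M D K H x' z' u' hδ hD hH hK 0 t l' l κ)).mul_left (c * ν * T κ 0 s t l l')
    refine h.congr fun u => ?_
    rw [hTinv]; simp only [add_zero]; ring
  have hS2 : ∀ t s l' l κ, Summable fun u : Fin (d + 1) → ℤ =>
      c * ν * (D l u * T κ 0 s t l l' * (H κ (u - s) * K l' (u - s + t) - H κ u * K l' (u + t))) := by
    intro t s l' l κ
    have h1 : Summable fun u : Fin (d + 1) → ℤ => (H κ (u - s) * K l' (u - s + t)) * D l u := by
      have := (Equiv.subRight s).summable_iff.2 (summable_DHK M D K H x' z' u' hδ hD hH hK s t l' l κ)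
      refine this.congr fun u => ?_
      simp only [Function.comp_apply, Equiv.subRight_apply, sub_add_cancel]
    have h2 := summable_DHK M D K H x' z' u' hδ hD hH hK 0 t l' l κ
    simp only [add_zero] at h2
    refine ((h1.sub h2).mul_left (c * ν * T κ 0 s t l l')).congr fun u => ?_
    ring
  -- exchange the lattice sum with the five finite sums on both sides
  rw [Summable.tsum_finsetSum (fun t _ => summable_sum fun s _ => summable_sum fun l' _ =>
        summable_sum fun l _ => summable_sum fun κ _ => hS1 t s l' l κ),
      Summable.tsum_finsetSum (fun t _ => summable_sum fun s _ => summable_sum fun l' _ =>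
        summable_sum fun l _ => summable_sum fun κ _ => hS2 t s l' l κ)]
  refine Finset.sum_congr rfl fun t _ => ?_
  rw [Summable.tsum_finsetSum (fun s _ => summable_sum fun l' _ => summable_sum fun l _ =>
        summable_sum fun κ _ => hS1 t s l' l κ),
      Summable.tsum_finsetSum (fun s _ => summable_sum fun l' _ => summable_sum fun l _ =>
        summable_sum fun κ _ => hS2 t s l' l κ)]
  refine Finset.sum_congr rfl fun s _ => ?_
  rw [Summable.tsum_finsetSum (fun l' _ => summable_sum fun l _ => summable_sum fun κ _ => hS1 t s l' l κ),
      Summable.tsum_finsetSum (fun l' _ => summable_sum fun l _ => summable_sum fun κ _ => hS2 t s l' l κ)]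
  refine Finset.sum_congr rfl fun l' _ => ?_
  rw [Summable.tsum_finsetSum (fun l _ => summable_sum fun κ _ => hS1 t s l' l κ),
      Summable.tsum_finsetSum (fun l _ => summable_sum fun κ _ => hS2 t s l' l κ)]
  refine Finset.sum_congr rfl fun l _ => ?_
  rw [Summable.tsum_finsetSum (fun κ _ => hS1 t s l' l κ), Summable.tsum_finsetSum (fun κ _ => hS2 t s l' l κ)]
  refine Finset.sum_congr rfl fun κ _ => ?_
  -- one family: constants out, split, reindex the shifted piece by `u ↦ u − s`
  have hA := summable_DHK M D K H x' z' u' hδ hD hH hK s t l' l κ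
  have hB0 := summable_DHK M D K H x' z' u' hδ hD hH hK 0 t l' l κ
  simp only [add_zero] at hB0
  have hshift := tsum_mul_shift (fun u => H κ u * K l' (u + t)) (D l) s
  calc ∑' u, c * ν * ((D l (u + s) - D l u) * H κ u * T κ u (u + s) (u + t) l l' * K l' (u + t))
      = ∑' u, (c * ν * T κ 0 s t l l') * ((H κ u * K l' (u + t)) * D l (u + s) - (H κ u * K l' (u + t)) * D l u) :=
        tsum_congr fun u => by rw [hTinv]; ring
    _ = (c * ν * T κ 0 s t l l') * (∑' u, (H κ u * K l' (u + t)) * D l (u + s) - ∑' u, (H κ u * K l' (u + t)) * D l u) := by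
        rw [tsum_mul_left, hA.tsum_sub hB0]
    _ = (c * ν * T κ 0 s t l l') * (∑' u, (H κ (u - s) * K l' (u - s + t)) * D l u - ∑' u, (H κ u * K l' (u + t)) * D l u) := by
        rw [hshift]
    _ = ∑' u, c * ν * (D l u * T κ 0 s t l l' * (H κ (u - s) * K l' (u - s + t) - H κ u * K l' (u + t))) := by
        have h1 : Summable fun u : Fin (d + 1) → ℤ => (H κ (u - s) * K l' (u - s + t)) * D l u := by
          have := (Equiv.subRight s).summable_iff.2 hA
          refine this.congr fun u => ?_
          simp only [Function.comp_apply, Equiv.subRight_apply, sub_add_cancel]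
        rw [← h1.tsum_sub hB0, ← tsum_mul_left]
        exact tsum_congr fun u => by ring

/-- [folklore] THE ABEL-TRANSFORMED `D`-STEP TERM, POINTWISE: the product of the two regular legs is box-Lipschitz
(`TaylorTrilinearPairing.abs_prod_shift_sub_le`), the sup of `D`:
`|Σ c ν D u·T₀·(H(u−s)K(u−s+t) − H u K(u+t))| ≤ |B|²(d+1)³·(cν)·C_T·ε_D·(R/M)·e^{3δR}·(C′_H C_K + C_H C′_K)·(weight at u)`. -/
theorem abs_stepD_shifted_le (hc : 0 ≤ c) (hν : 0 ≤ ν) (hδ : 0 ≤ δ) (hCH' : 0 ≤ CH') (hCK' : 0 ≤ CK')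
    (hD : ∀ l w, |D l w| ≤ εD * Real.exp (-δ * l1 (quo M w - x')))
    (hH : ∀ κ v, |H κ v| ≤ CH * Real.exp (-δ * l1 (quo M v - u')))
    (hH' : ∀ κ v j, |H κ (v + Pi.single j 1) - H κ v| ≤ CH' / M * Real.exp (-δ * l1 (quo M v - u')))
    (hK : ∀ l y, |K l y| ≤ CK * Real.exp (-δ * l1 (quo M y - z')))
    (hK' : ∀ l y j, |K l (y + Pi.single j 1) - K l y| ≤ CK' / M * Real.exp (-δ * l1 (quo M y - z')))
    (hB : ∀ s ∈ B, LatticeForm.l1 s ≤ R) (hT0 : ∀ κ v w y l l', |T κ v w y l l'| ≤ CT) (u : Fin (d + 1) → ℤ) :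
    |∑ t ∈ B, ∑ s ∈ B, ∑ l' : Fin (d + 1), ∑ l : Fin (d + 1), ∑ κ : Fin (d + 1),
        c * ν * (D l u * T κ 0 s t l l' * (H κ (u - s) * K l' (u - s + t) - H κ u * K l' (u + t)))| ≤
      ((B.card : ℝ) ^ 2 * ((d : ℝ) + 1) ^ 3 * ((c * ν) * CT * εD *
        ((R / M) * Real.exp (3 * δ * R) * (CH' * CK + CH * CK')))) *
        Real.exp (-δ * (l1 (quo M u - x') + l1 (quo M u - u') + l1 (quo M u - z'))) := by
  have hM : (0 : ℝ) < M := by exact_mod_cast Nat.pos_of_ne_zero (NeZero.ne M)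
  have hexp3 : (R / M) * Real.exp (2 * δ * R) * (CH' * (CK * Real.exp (δ * R)) + CH * (CK' * Real.exp (δ * R))) =
      (R / M) * Real.exp (3 * δ * R) * (CH' * CK + CH * CK') := by
    have h : Real.exp (2 * δ * R) * Real.exp (δ * R) = Real.exp (3 * δ * R) := by rw [← Real.exp_add]; ring_nf
    rw [← h]; ring
  rw [← hexp3]
  have hCT : 0 ≤ CT := (abs_nonneg _).trans (hT0 0 u u u 0 0)
  have hCK : 0 ≤ CK := nonneg_of_abs_le_mul_exp hδ (l1_nonneg _) (hK 0 u)
  rw [mul_assoc (((B.card : ℝ) ^ 2 * ((d : ℝ) + 1) ^ 3))]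
  refine abs_sum5_le B fun t ht s hs l' l κ => ?_
  have htR : l1 t ≤ R := l1_le_of_natl1_le (hB t ht)
  -- the shifted column `y ↦ K l′ (y + t)` is a leg with constants inflated by `e^{δ|t|₁} ≤ e^{δR}`
  have hKt : ∀ y, |K l' (y + t)| ≤ CK * Real.exp (δ * R) * Real.exp (-δ * l1 (quo M y - z')) := by
    intro y
    calc |K l' (y + t)| ≤ CK * Real.exp (δ * l1 t) * Real.exp (-δ * l1 (quo M y - z')) :=
          weight_shift_le M hδ hCK y t z' (hK l' (y + t))
      _ ≤ CK * Real.exp (δ * R) * Real.exp (-δ * l1 (quo M y - z')) := by gcongr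
  have hKt' : ∀ y j, |K l' (y + Pi.single j 1 + t) - K l' (y + t)| ≤
      CK' * Real.exp (δ * R) / M * Real.exp (-δ * l1 (quo M y - z')) := by
    intro y j
    have h := unit_step_shift_le M hδ (div_nonneg hCK' hM.le) (fun v i => hK' l' v i) t y j
    rw [show y + Pi.single j 1 + t = y + t + Pi.single j 1 by abel]
    calc |K l' (y + t + Pi.single j 1) - K l' (y + t)|
        ≤ CK' / M * Real.exp (δ * l1 t) * Real.exp (-δ * l1 (quo M y - z')) := h
      _ ≤ CK' / M * Real.exp (δ * R) * Real.exp (-δ * l1 (quo M y - z')) := by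
          have : 0 ≤ CK' / M := div_nonneg hCK' hM.le
          gcongr
      _ = _ := by ring
  have hprod : |H κ (u - s) * K l' (u - s + t) - H κ u * K l' (u + t)| ≤
      (R / M) * Real.exp (2 * δ * R) * (CH' * (CK * Real.exp (δ * R)) + CH * (CK' * Real.exp (δ * R))) *
        Real.exp (-δ * (l1 (quo M u - u') + l1 (quo M u - z'))) :=
    abs_prod_shift_sub_le M (H := H κ) (K := fun y => K l' (y + t)) (a₁ := u') (a₂ := z') (R := R)
      hδ hCH' (by positivity : 0 ≤ CK' * Real.exp (δ * R)) (hH κ) (hH' κ) hKt hKt' u (hB s hs)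
  have e1 := hD l u
  have e3 : |T κ 0 s t l l'| ≤ CT := hT0 κ 0 s t l l'
  have hεD : 0 ≤ εD * Real.exp (-δ * l1 (quo M u - x')) := (abs_nonneg _).trans e1
  rw [abs_mul, abs_of_nonneg (mul_nonneg hc hν), abs_mul, abs_mul]
  calc c * ν * (|D l u| * |T κ 0 s t l l'| * |H κ (u - s) * K l' (u - s + t) - H κ u * K l' (u + t)|)
      ≤ c * ν * ((εD * Real.exp (-δ * l1 (quo M u - x'))) * CT *
          ((R / M) * Real.exp (2 * δ * R) * (CH' * (CK * Real.exp (δ * R)) + CH * (CK' * Real.exp (δ * R))) *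
            Real.exp (-δ * (l1 (quo M u - u') + l1 (quo M u - z'))))) := by
        refine mul_le_mul_of_nonneg_left ?_ (mul_nonneg hc hν)
        exact mul_le_mul (mul_le_mul e1 e3 (abs_nonneg _) hεD) hprod (abs_nonneg _) (mul_nonneg hεD hCT)
    _ = (c * ν) * CT * εD *
          ((R / M) * Real.exp (2 * δ * R) * (CH' * (CK * Real.exp (δ * R)) + CH * (CK' * Real.exp (δ * R)))) *
          (Real.exp (-δ * l1 (quo M u - x')) * Real.exp (-δ * (l1 (quo M u - u') + l1 (quo M u - z')))) := by
        ring
    _ = _ := by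
        rw [← Real.exp_add]
        congr 2
        ring

end DiffLeg

end Summit.QuantumFields.BalabanUV.Beta.GAN24.TaylorTrilinearDiffSlices

end
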